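import Mathlib
import HarnessLib
import Literature.Probability.Percolation.HalfSpacePinnedPairs
import Literature.Probability.Percolation.ConstrainedClusters

/-!
# Low-point identity (route `PercLowPointHalfSpace`, item `LowPointIdentity`): shift lemmas

Helper file for `PercLowPointHalfSpaceLowPointIdentity.lean` (item `stmt-CriticalPhenomena-0916`,
`Summit.CriticalPhenomena.PercolationContinuityZ3.Theses.PercLowPointHalfSpace.LowPointIdentity`):
elementary facts about the events `{x ↔ y in S}` (`openConnIn`) of bond percolation, the level
half-spaces `{x ∈ ℤ^d | l ≤ x₀}`, the *lowest level* of an open connection `0 ↔ w`, and the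
behaviour of `openConnIn`, of the half-space cluster `U` (`halfSpaceCluster`), of its footprint
(`halfSpaceFootprint`) and of the floor-pinned pairs (`halfSpacePinnedPairs`) under the shift
`ω ↦ ω + s` of configurations (`BondConfig.relabel (sym2Equiv (Site.shift s))`, whose
`P_p`-invariance is `bondPercolation_map_shift`).

All statements are deterministic (no measure). Sources: G. Grimmett, *Percolation*, 2nd ed.
(1999), §1.3 and §7.2 p. 148 (paths "in `A`"); the objects are those of
`Literature/Probability/Percolation/HalfSpacePinnedPairs.lean`.
-/

noncomputable section

namespace Summit.CriticalPhenomena.PercolationContinuityZ3.Theorems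

open MeasureTheory Literature.Probability.Percolation Literature.Probability.LatticeModels
open scoped ENNReal

namespace LowPoint

/-- The shift `ω ↦ ω + s` of bond configurations of `ℤ^d` (local notation). -/
local notation "𝑻[" s "]" => BondConfig.relabel (sym2Equiv (Site.shift s))

/-! ## Elementary facts about `{x ↔ y in S}` -/

section General

variable {V : Type*}

/-- `{x ↔ y in S}` is symmetric. [folklore] -/
theorem conn_symm {S : Set V} {x y : V} {ω : BondConfig V} (h : ω ∈ openConnIn S x y) :
    ω ∈ openConnIn S y x := by
  obtain ⟨hx, hy, h⟩ := h
  exact ⟨hy, hx, h.symm⟩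

/-- `{x ↔ y in S}` is transitive. [folklore] -/
theorem conn_trans {S : Set V} {x y z : V} {ω : BondConfig V} (h₁ : ω ∈ openConnIn S x y)
    (h₂ : ω ∈ openConnIn S y z) : ω ∈ openConnIn S x z := by
  obtain ⟨hx, _, h⟩ := h₁
  obtain ⟨_, hz, h'⟩ := h₂
  exact ⟨hx, hz, h.trans h'⟩

/-- `x ↔ x in S` for `x ∈ S`. [folklore] -/
theorem conn_refl {S : Set V} {x : V} (ω : BondConfig V) (hx : x ∈ S) :
    ω ∈ openConnIn S x x :=
  ⟨hx, hx, SimpleGraph.Reachable.refl _⟩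

/-- `{x ↔ y in S}` is monotone in `S`. [folklore] -/
theorem conn_mono {S S' : Set V} (h : S ⊆ S') {x y : V} {ω : BondConfig V}
    (hω : ω ∈ openConnIn S x y) : ω ∈ openConnIn S' x y := by
  obtain ⟨hx, hy, hr⟩ := hω
  exact ⟨h hx, h hy, hr.map (SimpleGraph.induceHomOfLE (G := openGraph ω) h).toHom⟩

/-- `{x ↔ y in S} ⊆ {x ↔ y}`. [folklore] -/
theorem conn_reachable {S : Set V} {x y : V} {ω : BondConfig V} (h : ω ∈ openConnIn S x y) :
    (openGraph ω).Reachable x y := by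
  obtain ⟨hx, hy, hr⟩ := h
  exact (reachable_within_top_of_reachable_induce S (a := ⟨x, hx⟩) (b := ⟨y, hy⟩) hr).mono
    inf_le_left

/-- `{x ↔ y in S}` as membership of `y` in the constrained cluster of `x` (`x ∈ S`).
[folklore] -/
theorem conn_iff_mem_cluster {S : Set V} {x y : V} {ω : BondConfig V} (hx : x ∈ S) :
    ω ∈ openConnIn S x y ↔ y ∈ openClusterIn (withinGraph ⊤ S) ω x := by
  rw [openConnIn_eq_openConnVia hx]
  rfl

/-- Walk form of `cluster_subset_of_subset`: an open walk in `S` starting in the constrained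
cluster of `x`, all of whose cluster lies in `S'`, is an open walk in `S'`. [folklore] -/
theorem reachable_transfer {S S' : Set V} {ω : BondConfig V} {x : V}
    (h : openClusterIn (withinGraph ⊤ S) ω x ⊆ S') {a y : V}
    (q : (openGraph ω ⊓ withinGraph ⊤ S).Walk a y)
    (ha : (openGraph ω ⊓ withinGraph ⊤ S).Reachable x a) :
    (openGraph ω ⊓ withinGraph ⊤ S').Reachable a y := by
  induction q with
  | nil => exact SimpleGraph.Reachable.refl _
  | @cons a b c hab q ih =>
    have hb : (openGraph ω ⊓ withinGraph ⊤ S).Reachable x b := ha.trans hab.reachable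
    have haS' : a ∈ S' := h (mem_openClusterIn_iff.2 ha)
    have hbS' : b ∈ S' := h (mem_openClusterIn_iff.2 hb)
    have hab' : (openGraph ω ⊓ withinGraph ⊤ S').Adj a b := ⟨hab.1, hab.2.1, haS', hbS'⟩
    exact hab'.reachable.trans (ih hb)

/-- If the constrained cluster of `x` in `S` lies inside `S'`, it is contained in the constrained
cluster of `x` in `S'` (an open path of the first cluster is an open path in `S'`). [folklore] -/
theorem cluster_subset_of_subset {S S' : Set V} {ω : BondConfig V} {x : V}
    (h : openClusterIn (withinGraph ⊤ S) ω x ⊆ S') :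
    openClusterIn (withinGraph ⊤ S) ω x ⊆ openClusterIn (withinGraph ⊤ S') ω x := by
  intro y hy
  rw [mem_openClusterIn_iff] at hy ⊢
  obtain ⟨p⟩ := hy
  exact reachable_transfer h p (SimpleGraph.Reachable.refl _)

end General

/-! ## Level half-spaces and shifts -/

variable {d : ℕ}

section Level

variable [NeZero d]

/-- Level half-spaces decrease with the level. [folklore] -/
theorem level_antitone {l l' : ℤ} (h : l ≤ l') :
    {x : Site d | l' ≤ x 0} ⊆ {x : Site d | l ≤ x 0} :=
  fun _ hx => le_trans h hx

/-- The preimage of a level half-space under the translation by `s`. [folklore] -/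
theorem preimage_add_level (s : Site d) (l : ℤ) :
    ((fun x : Site d => x + s) ⁻¹' {x : Site d | l ≤ x 0}) =
      {x : Site d | l - s 0 ≤ x 0} := by
  ext x
  simp only [Set.mem_preimage, Set.mem_setOf_eq, Pi.add_apply]
  omega

/-- Every open path lies in some level half-space. [folklore] -/
theorem exists_level_of_walk {ω : BondConfig (Site d)} {x y : Site d}
    (p : (openGraph ω).Walk x y) :
    ∃ l : ℤ, ω ∈ openConnIn {x : Site d | l ≤ x 0} x y := by
  induction p with
  | @nil a => exact ⟨a 0, conn_refl ω (le_refl (a 0))⟩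
  | @cons a b c h _ ih =>
    obtain ⟨l, hl⟩ := ih
    refine ⟨min (a 0) (min (b 0) l), conn_trans ?_ (conn_mono (level_antitone ?_) hl)⟩
    · refine ⟨?_, ?_, SimpleGraph.Adj.reachable ?_⟩
      · show min (a 0) (min (b 0) l) ≤ a 0
        exact min_le_left _ _
      · show min (a 0) (min (b 0) l) ≤ b 0
        exact le_trans (min_le_right _ _) (min_le_left _ _)
      · exact h
    · exact le_trans (min_le_right _ _) (min_le_right _ _)

/-- **The lowest level.** If `0 ↔ w`, there is a level `l₀` with `0 ↔ w` inside `{l₀ ≤ x₀}`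
but not inside `{l₀ + 1 ≤ x₀}`. [folklore] -/
theorem exists_lowest_level {ω : BondConfig (Site d)} {w : Site d}
    (h : (openGraph ω).Reachable 0 w) :
    ∃ l₀ : ℤ, ω ∈ openConnIn {x : Site d | l₀ ≤ x 0} 0 w ∧
      ω ∉ openConnIn {x : Site d | l₀ + 1 ≤ x 0} 0 w := by
  obtain ⟨l, hl⟩ := exists_level_of_walk h.some
  have hne : {l : ℤ | ω ∈ openConnIn {x : Site d | l ≤ x 0} 0 w}.Nonempty := ⟨l, hl⟩
  have hbdd : BddAbove {l : ℤ | ω ∈ openConnIn {x : Site d | l ≤ x 0} 0 w} := by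
    refine ⟨0, fun l' hl' => ?_⟩
    have h0 : (0 : Site d) ∈ {x : Site d | l' ≤ x 0} := hl'.1
    simpa using h0
  refine ⟨sSup {l : ℤ | ω ∈ openConnIn {x : Site d | l ≤ x 0} 0 w}, Int.csSup_mem hne hbdd,
    fun h' => ?_⟩
  have := le_csSup hbdd h'
  omega

end Level

section Shift

/-- Shifting the configuration by `s` carries the constrained cluster of `x` in the region
`R - s` onto the constrained cluster of `x + s` in `R`. [folklore] -/
theorem openClusterIn_shift_preimage (s : Site d) (R : Set (Site d)) (ω : BondConfig (Site d))
    (x : Site d) :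
    openClusterIn (withinGraph ⊤ R) (𝑻[s] ω) (x + s) =
      Site.shift s '' openClusterIn (withinGraph ⊤ ((fun u : Site d => u + s) ⁻¹' R)) ω x :=
  openClusterIn_relabel (Site.shift s) (K := withinGraph ⊤ ((fun u : Site d => u + s) ⁻¹' R))
    (K' := withinGraph ⊤ R)
    (fun u v => by
      simp only [withinGraph_adj, SimpleGraph.top_adj, Site.shift_apply, Set.mem_preimage, ne_eq,
        add_left_inj])
    ω x

/-- **Covariance of `{x ↔ y in R}` under shifts**:
`ω + s ∈ {x + s ↔ y + s in R} ↔ ω ∈ {x ↔ y in R - s}`. [folklore] -/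
theorem shift_mem_openConnIn_iff (s : Site d) (R : Set (Site d)) (ω : BondConfig (Site d))
    (x y : Site d) :
    𝑻[s] ω ∈ openConnIn R (x + s) (y + s) ↔
      ω ∈ openConnIn ((fun u : Site d => u + s) ⁻¹' R) x y := by
  by_cases hx : x + s ∈ R
  · have hx' : x ∈ (fun u : Site d => u + s) ⁻¹' R := hx
    rw [openConnIn_eq_openConnVia hx, openConnIn_eq_openConnVia hx']
    change y + s ∈ openClusterIn (withinGraph ⊤ R) (𝑻[s] ω) (x + s) ↔
      y ∈ openClusterIn (withinGraph ⊤ ((fun u : Site d => u + s) ⁻¹' R)) ω x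
    rw [openClusterIn_shift_preimage s R ω x]
    exact (Site.shift s).injective.mem_set_image
  · constructor
    · exact fun h => (hx h.1).elim
    · exact fun h => (hx h.1).elim

/-- The same with the shift on the endpoints of the right-hand side:
`ω + s ∈ {x ↔ y in R} ↔ ω ∈ {x - s ↔ y - s in R - s}`. [folklore] -/
theorem shift_mem_openConnIn_iff_sub (s : Site d) (R : Set (Site d)) (ω : BondConfig (Site d))
    (x y : Site d) :
    𝑻[s] ω ∈ openConnIn R x y ↔
      ω ∈ openConnIn ((fun u : Site d => u + s) ⁻¹' R) (x - s) (y - s) := by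
  have := shift_mem_openConnIn_iff s R ω (x - s) (y - s)
  rwa [sub_add_cancel, sub_add_cancel] at this

variable [NeZero d]

/-- The half-space cluster of the origin of the shifted configuration `ω + v` is the cluster of
`-v` inside the level half-space `{-v₀ ≤ x₀}`, shifted by `v`. [folklore] -/
theorem mem_halfSpaceCluster_shift_iff (v u : Site d) (ω : BondConfig (Site d)) :
    u ∈ halfSpaceCluster (𝑻[v] ω) ↔
      ω ∈ openConnIn {x : Site d | -v 0 ≤ x 0} (-v) (u - v) := by
  rw [mem_halfSpaceCluster_iff, shift_mem_openConnIn_iff_sub]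
  rw [show halfSpace d = {x : Site d | 0 ≤ x 0} from rfl, preimage_add_level, zero_sub, zero_sub]

/-- `v` is a floor-pinned `w`-pair of the half-space cluster of `ω + v` iff, in `ω`, the point
`-v` is joined to `0` and to `w` inside `{-v₀ ≤ x₀}` and (`v₀ = 0` or `0 ↮ w` inside
`{1 - v₀ ≤ x₀}`). [folklore] -/
theorem mem_pinned_shift_iff (v w : Site d) (ω : BondConfig (Site d)) :
    v ∈ halfSpacePinnedPairs (𝑻[v] ω) w ↔
      ω ∈ openConnIn {x : Site d | -v 0 ≤ x 0} (-v) 0 ∧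
        ω ∈ openConnIn {x : Site d | -v 0 ≤ x 0} (-v) w ∧
          (v 0 = 0 ∨ ω ∉ openConnIn {x : Site d | 1 - v 0 ≤ x 0} 0 w) := by
  rw [mem_halfSpacePinnedPairs_iff', mem_halfSpaceCluster_shift_iff, mem_halfSpaceCluster_shift_iff,
    sub_self, add_sub_cancel_left, shift_mem_openConnIn_iff_sub, preimage_add_level, sub_self,
    add_sub_cancel_left]

/-- The footprint of the half-space cluster of `ω + v` is the number of points of the cluster of
`-v` inside `{-v₀ ≤ x₀}` lying on its floor `{x₀ = -v₀}`. [folklore] -/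
theorem footprint_shift_eq (v : Site d) (ω : BondConfig (Site d)) :
    halfSpaceFootprint (𝑻[v] ω) =
      ({u | ω ∈ openConnIn {x : Site d | -v 0 ≤ x 0} (-v) u} ∩ {u | u 0 = -v 0}).encard := by
  rw [halfSpaceFootprint_def]
  have hset : halfSpaceCluster (𝑻[v] ω) ∩ {x | x 0 = 0} =
      Site.shift v ''
        ({u | ω ∈ openConnIn {x : Site d | -v 0 ≤ x 0} (-v) u} ∩ {u | u 0 = -v 0}) := by
    ext u
    constructor
    · rintro ⟨h1, h2⟩
      rw [mem_halfSpaceCluster_shift_iff] at h1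
      have h2' : u 0 = 0 := h2
      refine ⟨u - v, ⟨h1, ?_⟩, sub_add_cancel u v⟩
      show (u - v) 0 = -v 0
      rw [Pi.sub_apply, h2', zero_sub]
    · rintro ⟨u', ⟨h1, h2⟩, rfl⟩
      have h2' : u' 0 = -v 0 := h2
      refine ⟨?_, ?_⟩
      · rw [mem_halfSpaceCluster_shift_iff, Site.shift_apply, add_sub_cancel_right]
        exact h1
      · show (Site.shift v u') 0 = 0
        rw [Site.shift_apply, Pi.add_apply, h2', neg_add_cancel]
  rw [hset, (Site.shift v).injective.encard_image]

end Shift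

end LowPoint

end Summit.CriticalPhenomena.PercolationContinuityZ3.Theorems

end
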